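import Mathlib.Algebra.Field.Basic
import Mathlib.Tactic.LinearCombination
import Mathlib.Tactic.Ring
import Mathlib.Tactic.NormNum
import HarnessLib

/-!
# Venture HSemireg — the pair correspondences of the Case-A types at infinity (memo §62 (B)/(C))

Seat w1-tw-2 of the computation cell `pub-hsemireg` (W1; memo `widen/W1/PSTU-READ-tw2.md` §62, «THE
Ã-SPACE INFINITY LEMMA AND THE CURVE AT INFINITY W_∞ OF THE WITNESS SURFACE», READ ×2 by w1-tw-1 g16,
cell bus l.26030; companion of `EscapeLocusClosedForm` and of w1-tw-1's `NormConditionExclusions`).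

Setting of the memo (NOT formalised here). A witness is a pair `(Ã, P₄)` with `P₄ = u⁴ + p₃u³ + p₂u² +
p₁u + p₀` a monic quartic dividing `R_Ã = F − mÃ²`, subject to the two NORM CONDITIONS
`N1 : p₀² = K_b K_c` and `N2 : p₂² + 2p₀ − 2p₁p₃ = −(K_b + K_c)`. At a point of the curve at infinity
`W_∞` whose four roots stay bounded (Case A) the reductions of the roots of `P₄` form a size-4 multiset
`T` drawn from the roots `r₁, r₂, r₃` of the limiting cubic `c` (and the two constants `ω, ω'`), and
`N1/N2` become `(∏ T)² = K_b K_c`, `e₂(T²) = −(K_b + K_c)`. Eliminating the root of `c` that is NOT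
one of the two abscissae `(u_s, u_t)` gives the PAIR CORRESPONDENCE CURVE of the type — the explicit
plane curves that the level-1 candidate job intersects (memo §62 (C); kit cand3/cand5). This file
kernel-checks exactly that field algebra:

* `quartic_vieta`, `e4_of_squares`, `e2_of_squares` — the coefficient form of the norm conditions:
  for a monic quartic with roots `ρ₁..ρ₄`, `e₄(ρ²) = p₀²` and `e₂(ρ²) = p₂² − 2p₁p₃ + 2p₀`
  (so `N1 ⟺ e₄(ρ²) = K_bK_c`, `N2 ⟺ e₂(ρ²) = −(K_b + K_c)`).
* `typeA2_correspondence` — type `A2(x)`, `T = {x, r₁, r₂, r₃}` (`x ∈ {ω, ω'}` a constant), pair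
  `(r₁, r₂)`, `S = r₁² + r₂²`, `P = r₁²r₂²`, third root eliminated:
  `E_{A2(x)} : x²P(K_b + K_c + x²S + P) + K_bK_c(x² + S) = 0`.
* `typeA5_product_factor`, `typeA5_correspondence` — type `A5`, `T = {r_i, r_j, r_k, r_k}`, pair = the
  two SINGLE roots, `S = r_i² + r_j²`, `P = r_i²r_j²`: `E_{A5} : (P + K_b)²(P + K_c)² = 4K_bK_c S² P`.
* `typeA5_mixed_correspondence` — type `A5`, pair = (single root `t`, double root `U`), the other single
  root eliminated: `E'_{A5} : U⁸t² + 2U⁶t⁴ + (K_b + K_c)U⁴t² + K_bK_c t² + 2K_bK_c U² = 0`.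
* `quadruple_type_relation` (+ the member's numerics `member_plane*_quadruple_type_obstruction`) — the
  double-root stratum check of §62 (B)(γ): type `{r, r, r, r}` forces `36 K_bK_c = (K_b + K_c)²`; at the
  member `K = (16, 2, −3)` the three differences `36K_bK_c − (K_b + K_c)²` are `−217 = −7·31`,
  `−1897 = −7·271`, `828 = 2²·3²·23`, non-zero in every characteristic outside `{2, 3, 7, 23, 31, 271}`.

HONEST FRAMING. Elementary identities in a commutative ring; no curve, witness surface, incidence or
semiregularity map is formalised, the passage from a branch at infinity to the multiset `T` (memo §62
(B), a valuation argument) is NOT formalised; nothing here says that HC, HC_CM or HC_AV holds, and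
nothing here is a new case of anything.
-/

namespace Summit.Ventures.HSemireg

namespace InfinityTypeCorrespondences

variable {R : Type*} [CommRing R]

/-! ### The norm conditions in root form (Vieta for a monic quartic) -/

/-- Vieta: the monic quartic with roots `ρ₁, ρ₂, ρ₃, ρ₄` is `u⁴ + p₃u³ + p₂u² + p₁u + p₀` with
`p₃ = −e₁`, `p₂ = e₂`, `p₁ = −e₃`, `p₀ = e₄` of the roots. -/
theorem quartic_vieta (u ρ₁ ρ₂ ρ₃ ρ₄ : R) :
    (u - ρ₁) * (u - ρ₂) * (u - ρ₃) * (u - ρ₄)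
      = u ^ 4 + (-(ρ₁ + ρ₂ + ρ₃ + ρ₄)) * u ^ 3
        + (ρ₁ * ρ₂ + ρ₁ * ρ₃ + ρ₁ * ρ₄ + ρ₂ * ρ₃ + ρ₂ * ρ₄ + ρ₃ * ρ₄) * u ^ 2
        + (-(ρ₁ * ρ₂ * ρ₃ + ρ₁ * ρ₂ * ρ₄ + ρ₁ * ρ₃ * ρ₄ + ρ₂ * ρ₃ * ρ₄)) * u
        + ρ₁ * ρ₂ * ρ₃ * ρ₄ := by
  ring

/-- `N1` in root form: `e₄(ρ₁², ρ₂², ρ₃², ρ₄²) = p₀²`. -/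
theorem e4_of_squares {ρ₁ ρ₂ ρ₃ ρ₄ p₀ : R} (hp₀ : p₀ = ρ₁ * ρ₂ * ρ₃ * ρ₄) :
    ρ₁ ^ 2 * ρ₂ ^ 2 * ρ₃ ^ 2 * ρ₄ ^ 2 = p₀ ^ 2 := by
  rw [hp₀]; ring

/-- `N2` in root form: `e₂(ρ₁², ρ₂², ρ₃², ρ₄²) = p₂² − 2p₁p₃ + 2p₀` (Newton–Girard for the squares). -/
theorem e2_of_squares {ρ₁ ρ₂ ρ₃ ρ₄ p₀ p₁ p₂ p₃ : R} (hp₀ : p₀ = ρ₁ * ρ₂ * ρ₃ * ρ₄)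
    (hp₁ : p₁ = -(ρ₁ * ρ₂ * ρ₃ + ρ₁ * ρ₂ * ρ₄ + ρ₁ * ρ₃ * ρ₄ + ρ₂ * ρ₃ * ρ₄))
    (hp₂ : p₂ = ρ₁ * ρ₂ + ρ₁ * ρ₃ + ρ₁ * ρ₄ + ρ₂ * ρ₃ + ρ₂ * ρ₄ + ρ₃ * ρ₄)
    (hp₃ : p₃ = -(ρ₁ + ρ₂ + ρ₃ + ρ₄)) :
    ρ₁ ^ 2 * ρ₂ ^ 2 + ρ₁ ^ 2 * ρ₃ ^ 2 + ρ₁ ^ 2 * ρ₄ ^ 2 + ρ₂ ^ 2 * ρ₃ ^ 2 + ρ₂ ^ 2 * ρ₄ ^ 2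
      + ρ₃ ^ 2 * ρ₄ ^ 2 = p₂ ^ 2 - 2 * p₁ * p₃ + 2 * p₀ := by
  rw [hp₀, hp₁, hp₂, hp₃]; ring

/-- Hence the coefficient form of the second norm condition, `p₂² + 2p₀ − 2p₁p₃ = −(K_b + K_c)`, is the
root form `e₂(ρ²) = −(K_b + K_c)`. -/
theorem N2_root_form {ρ₁ ρ₂ ρ₃ ρ₄ p₀ p₁ p₂ p₃ Kb Kc : R} (hp₀ : p₀ = ρ₁ * ρ₂ * ρ₃ * ρ₄)
    (hp₁ : p₁ = -(ρ₁ * ρ₂ * ρ₃ + ρ₁ * ρ₂ * ρ₄ + ρ₁ * ρ₃ * ρ₄ + ρ₂ * ρ₃ * ρ₄))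
    (hp₂ : p₂ = ρ₁ * ρ₂ + ρ₁ * ρ₃ + ρ₁ * ρ₄ + ρ₂ * ρ₃ + ρ₂ * ρ₄ + ρ₃ * ρ₄)
    (hp₃ : p₃ = -(ρ₁ + ρ₂ + ρ₃ + ρ₄)) :
    p₂ ^ 2 + 2 * p₀ - 2 * p₁ * p₃ = -(Kb + Kc) ↔
      ρ₁ ^ 2 * ρ₂ ^ 2 + ρ₁ ^ 2 * ρ₃ ^ 2 + ρ₁ ^ 2 * ρ₄ ^ 2 + ρ₂ ^ 2 * ρ₃ ^ 2 + ρ₂ ^ 2 * ρ₄ ^ 2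
        + ρ₃ ^ 2 * ρ₄ ^ 2 = -(Kb + Kc) := by
  rw [e2_of_squares hp₀ hp₁ hp₂ hp₃]
  constructor <;> intro h <;> linear_combination h

/-! ### Type `A2(x)`: `T = {x, r₁, r₂, r₃}`, pair `(r₁, r₂)` -/

/-- Type `A2(x)` in the symmetric functions of the pair: with `X = x²`, `S = r₁² + r₂²`, `P = r₁²r₂²`
and `Q = r₃²` (the eliminated root), `N1 : X·P·Q = K_bK_c` and `N2 : X(S + Q) + P + S·Q = −(K_b + K_c)`
give the correspondence curve `E_{A2(x)} : X·P·(K_b + K_c + X·S + P) + K_bK_c·(X + S) = 0`. -/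
theorem typeA2_correspondence {X S P Q Kb Kc : R} (N1 : X * P * Q = Kb * Kc)
    (N2 : X * (S + Q) + P + S * Q = -(Kb + Kc)) :
    X * P * (Kb + Kc + X * S + P) + Kb * Kc * (X + S) = 0 := by
  linear_combination (X * P) * N2 - (X + S) * N1

/-- Type `A2(x)` in the roots themselves: `(x r₁ r₂ r₃)² = K_bK_c` and `e₂(x², r₁², r₂², r₃²) =
−(K_b + K_c)` give `E_{A2(x)}(r₁, r₂)`. -/
theorem typeA2_correspondence_roots {x r₁ r₂ r₃ Kb Kc : R} (N1 : (x * r₁ * r₂ * r₃) ^ 2 = Kb * Kc)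
    (N2 : x ^ 2 * r₁ ^ 2 + x ^ 2 * r₂ ^ 2 + x ^ 2 * r₃ ^ 2 + r₁ ^ 2 * r₂ ^ 2 + r₁ ^ 2 * r₃ ^ 2
      + r₂ ^ 2 * r₃ ^ 2 = -(Kb + Kc)) :
    x ^ 2 * (r₁ ^ 2 * r₂ ^ 2) * (Kb + Kc + x ^ 2 * (r₁ ^ 2 + r₂ ^ 2) + r₁ ^ 2 * r₂ ^ 2)
      + Kb * Kc * (x ^ 2 + (r₁ ^ 2 + r₂ ^ 2)) = 0 := by
  have N1' : x ^ 2 * (r₁ ^ 2 * r₂ ^ 2) * r₃ ^ 2 = Kb * Kc := by linear_combination N1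
  have N2' : x ^ 2 * ((r₁ ^ 2 + r₂ ^ 2) + r₃ ^ 2) + r₁ ^ 2 * r₂ ^ 2 + (r₁ ^ 2 + r₂ ^ 2) * r₃ ^ 2
      = -(Kb + Kc) := by linear_combination N2
  exact typeA2_correspondence N1' N2'

/-! ### Type `A5`: `T = {r_i, r_j, r_k, r_k}` -/

/-- Type `A5`, pair = the two single roots: with `S = r_i² + r_j²`, `P = r_i²r_j²`, `Q = r_k²`,
`N1 : P·Q² = K_bK_c` and `N2 : P + 2·S·Q + Q² = −(K_b + K_c)` give `(P + K_b)(P + K_c) = −2·S·Q·P`. -/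
theorem typeA5_product_factor {S P Q Kb Kc : R} (N1 : P * Q ^ 2 = Kb * Kc)
    (N2 : P + 2 * S * Q + Q ^ 2 = -(Kb + Kc)) :
    (P + Kb) * (P + Kc) = -(2 * S * Q * P) := by
  linear_combination P * N2 - N1

/-- Type `A5`, pair = the two single roots: the correspondence curve
`E_{A5} : (P + K_b)²(P + K_c)² = 4K_bK_c·S²·P`. -/
theorem typeA5_correspondence {S P Q Kb Kc : R} (N1 : P * Q ^ 2 = Kb * Kc)
    (N2 : P + 2 * S * Q + Q ^ 2 = -(Kb + Kc)) :
    (P + Kb) ^ 2 * (P + Kc) ^ 2 = 4 * Kb * Kc * S ^ 2 * P := by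
  have h := typeA5_product_factor N1 N2
  have hsq : (P + Kb) ^ 2 * (P + Kc) ^ 2 = 4 * S ^ 2 * P * (P * Q ^ 2) := by
    linear_combination ((P + Kb) * (P + Kc) - 2 * S * Q * P) * h
  rw [hsq, N1]; ring

/-- Type `A5` in the roots, pair = the single roots `(r₁, r₂)`, double root `r₃`. -/
theorem typeA5_correspondence_roots {r₁ r₂ r₃ Kb Kc : R} (N1 : (r₁ * r₂ * r₃ * r₃) ^ 2 = Kb * Kc)
    (N2 : r₁ ^ 2 * r₂ ^ 2 + r₁ ^ 2 * r₃ ^ 2 + r₁ ^ 2 * r₃ ^ 2 + r₂ ^ 2 * r₃ ^ 2 + r₂ ^ 2 * r₃ ^ 2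
      + r₃ ^ 2 * r₃ ^ 2 = -(Kb + Kc)) :
    (r₁ ^ 2 * r₂ ^ 2 + Kb) ^ 2 * (r₁ ^ 2 * r₂ ^ 2 + Kc) ^ 2
      = 4 * Kb * Kc * (r₁ ^ 2 + r₂ ^ 2) ^ 2 * (r₁ ^ 2 * r₂ ^ 2) := by
  have N1' : r₁ ^ 2 * r₂ ^ 2 * (r₃ ^ 2) ^ 2 = Kb * Kc := by linear_combination N1
  have N2' : r₁ ^ 2 * r₂ ^ 2 + 2 * (r₁ ^ 2 + r₂ ^ 2) * r₃ ^ 2 + (r₃ ^ 2) ^ 2 = -(Kb + Kc) := by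
    linear_combination N2
  exact typeA5_correspondence N1' N2'

/-- Type `A5`, MIXED pair = (single root `t`, double root `U`); with `X = t²`, `V = U²` and `J = j²`
the eliminated single root: `N1 : X·J·V² = K_bK_c`, `N2 : X·J + 2V(X + J) + V² = −(K_b + K_c)` give
`E'_{A5} : X·V²·(2·V·X + V² + K_b + K_c) + K_bK_c·(X + 2V) = 0`. -/
theorem typeA5_mixed_correspondence {X J V Kb Kc : R} (N1 : X * J * V ^ 2 = Kb * Kc)
    (N2 : X * J + 2 * V * (X + J) + V ^ 2 = -(Kb + Kc)) :
    X * V ^ 2 * (2 * V * X + V ^ 2 + Kb + Kc) + Kb * Kc * (X + 2 * V) = 0 := by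
  linear_combination (X * V ^ 2) * N2 - (X + 2 * V) * N1

/-- The same in the roots: the printed curve
`U⁸t² + 2U⁶t⁴ + (K_b + K_c)U⁴t² + K_bK_c t² + 2K_bK_c U² = 0` (memo §62 (C), `E'_{A5}`). -/
theorem typeA5_mixed_correspondence_roots {t j U Kb Kc : R} (N1 : (t * j * U * U) ^ 2 = Kb * Kc)
    (N2 : t ^ 2 * j ^ 2 + t ^ 2 * U ^ 2 + t ^ 2 * U ^ 2 + j ^ 2 * U ^ 2 + j ^ 2 * U ^ 2
      + U ^ 2 * U ^ 2 = -(Kb + Kc)) :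
    U ^ 8 * t ^ 2 + 2 * U ^ 6 * t ^ 4 + (Kb + Kc) * U ^ 4 * t ^ 2 + Kb * Kc * t ^ 2
      + 2 * Kb * Kc * U ^ 2 = 0 := by
  have N1' : t ^ 2 * j ^ 2 * (U ^ 2) ^ 2 = Kb * Kc := by linear_combination N1
  have N2' : t ^ 2 * j ^ 2 + 2 * U ^ 2 * (t ^ 2 + j ^ 2) + (U ^ 2) ^ 2 = -(Kb + Kc) := by
    linear_combination N2
  have h := typeA5_mixed_correspondence N1' N2'
  linear_combination h

/-! ### The double-root stratum check `{r, r, r, r}` (memo §62 (B)(γ)) -/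

/-- Type `{r, r, r, r}`: `N1 : (r⁴)² = K_bK_c` and `N2 : 6r⁴ = −(K_b + K_c)` force
`36·K_bK_c = (K_b + K_c)²`. -/
theorem quadruple_type_relation {r Kb Kc : R} (N1 : (r ^ 4) ^ 2 = Kb * Kc)
    (N2 : 6 * r ^ 4 = -(Kb + Kc)) : 36 * (Kb * Kc) = (Kb + Kc) ^ 2 := by
  linear_combination (6 * r ^ 4 - (Kb + Kc)) * N2 - 36 * N1

/-- The member `K = (16, 2, −3)`, plane `a = 1` (`(K_b, K_c) = (2, −3)`): `36K_bK_c − (K_b + K_c)² =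
−217 = −(7·31)`. -/
theorem member_plane1_quadruple_type_obstruction :
    (36 * (2 * (-3)) - (2 + (-3)) ^ 2 : ℤ) = -217 ∧ (217 : ℤ) = 7 * 31 := by
  constructor <;> norm_num

/-- Plane `a = 2` (`(K_b, K_c) = (16, −3)`): `36K_bK_c − (K_b + K_c)² = −1897 = −(7·271)`. -/
theorem member_plane2_quadruple_type_obstruction :
    (36 * (16 * (-3)) - (16 + (-3)) ^ 2 : ℤ) = -1897 ∧ (1897 : ℤ) = 7 * 271 := by
  constructor <;> norm_num

/-- Plane `a = 3` (`(K_b, K_c) = (16, 2)`): `36K_bK_c − (K_b + K_c)² = 828 = 2²·3²·23`. -/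
theorem member_plane3_quadruple_type_obstruction :
    (36 * (16 * 2) - (16 + 2) ^ 2 : ℤ) = 828 ∧ (828 : ℤ) = 2 ^ 2 * 3 ^ 2 * 23 := by
  constructor <;> norm_num

/-- Hence, in a commutative ring in which `36·K_bK_c ≠ (K_b + K_c)²`, no type `{r, r, r, r}` exists. -/
theorem quadruple_type_excluded {r Kb Kc : R} (h : 36 * (Kb * Kc) ≠ (Kb + Kc) ^ 2)
    (N1 : (r ^ 4) ^ 2 = Kb * Kc) (N2 : 6 * r ^ 4 = -(Kb + Kc)) : False :=
  h (quadruple_type_relation N1 N2)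

end InfinityTypeCorrespondences

end Summit.Ventures.HSemireg
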